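import Summits.MatrixMultiplication.OmegaCensus.STPPVosperSlackTwoLawT
import Summits.MatrixMultiplication.OmegaCensus.STPPVosperSlackTwoRows59L2AAsm
import Summits.MatrixMultiplication.OmegaCensus.STPPVosperSlackTwoRows59L2BAsm
import Summits.MatrixMultiplication.OmegaCensus.STPPVosperSlackTwoRows59L2CAsm
import Summits.MatrixMultiplication.OmegaCensus.STPPVosperSlackTwoRows59L2TblAAsm
import Summits.MatrixMultiplication.OmegaCensus.STPPVosperSlackTwoRows59L2TblBAsm
import Summits.MatrixMultiplication.OmegaCensus.STPPVosperSlackTwoRows59L2TblCAsm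
import Summits.MatrixMultiplication.OmegaCensus.STPPVosperTilingWordsPrunedQ
import Summits.MatrixMultiplication.OmegaCensus.STPPVosperTilingWordsPruned
import Summits.MatrixMultiplication.OmegaCensus.STPPHamidouneRodsethInverseTheorem
import Summits.MatrixMultiplication.OmegaCensus.STPPDisjointPacking

/-!
# ω-census (abelian STPP census): `{(2,2,3),(3,4,2),(3,4,2)} ⊄ ℤ₅₉` by the slack-2 partition law, table form (kernel, unconditional)

HONEST FRAMING (pub-omega census; verbatim): lottery ticket; floor = certified bounds/negative ranges.
Census EXCLUSION (seat pub-omega-stpp-1 gen 33 with the rows of seat pub-omega-stpp-2 gen 27, 2026-08-28), family (b2).  The three-block leaf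
`{(2,2,3),(3,4,2),(3,4,2)}` of the ℤ₅₉ STPP census has NO realisation: for the ROTATED family `(C, A, B)` (`stpp_rotate` twice) the `(3,4,2)` block `1`
reads `(a, b, c) = (2, 3, 4)` with the other blocks `[0, 2]` of sizes `(3,2,2)`, `(2,3,4)` — slack 2: `z + b + vol + a + L = 14 + 3 + 24 + 2 + 16 = 59` —
and `no_isSTPP_of_slack_two_tables` (`STPPVosperSlackTwoLawT.lean`; `a = 2`) applies with the kernel rows `rows59L2A_choose` (case A, table `tblZ59L2A`),
`rows59L2B_choose` (case B′, `tblZ59L2B`), `rows59L2C_lit` (case C, PRUNED checker `caseCDeadTP`, 14 holes, `tblZ59L2C`) and the words-cover table rows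
`dead59L2A` (direct, `blockDiffsWQ`), `dead59L2B` (direct, `blockDiffsWQ`), `dead59L2C` (role-swapped, `blockDiffsWP`) (`STPPVosperSlackTwoRows59L2*.lean`,
seat stpp-2 gen 27; tables `STPPVosperSlackTwoTablesZ59.lean`).  Hamidoune–Rødseth is the tree theorem `hamidouneRodsethInverseTheorem_holds`.  Census
consequence (lead's words only): one of the three open ℤ₅₉ leaves.  Nothing here is progress on `ω`.

References: H. Cohn, R. Kleinberg, B. Szegedy, C. Umans, FOCS 2005 (arXiv:math/0511460), Def. 5.1; A. G. Vosper, J. London Math. Soc. 31 (1956);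
Y. O. Hamidoune, Ø. J. Rødseth, Acta Arith. 92 (2000).
-/

open Finset
open scoped Pointwise

namespace Summit.MatrixMultiplication.OmegaCensus.CubeNB

open Literature.Computability.AlgebraicComplexity
open Literature.Combinatorics.Additive
open Summit.MatrixMultiplication.OmegaCensus.STPPKneser
open Summit.MatrixMultiplication.OmegaCensus.CubeNB.S2

/-- **`{(2,2,3),(3,4,2),(3,4,2)} ⊄ ℤ₅₉` (kernel, unconditional).**  No simultaneous-triple-product family of `ℤ/59` has size pattern
`(|A₀|,|B₀|,|C₀|) = (2,2,3)`, `(|A₁|,|B₁|,|C₁|) = (|A₂|,|B₂|,|C₂|) = (3,4,2)`. [cite: CohnKleinbergSzegedyUmans2005, Def. 5.1]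
[cite: Vosper1956, main theorem; Nathanson1996, Thm 2.7] [cite: HamidouneRodseth2000, main theorem (§1, p. 252)] -/
theorem no_isSTPP_zmod59_223_342_342 (A B C : Fin 3 → Finset (ZMod 59)) (hS : IsSTPP A B C)
    (hA : ∀ i, #(A i) = ![2, 3, 3] i) (hB : ∀ i, #(B i) = ![2, 4, 4] i) (hC : ∀ i, #(C i) = ![3, 2, 2] i) : False := by
  haveI : Fact (Nat.Prime 59) := ⟨by norm_num⟩
  have hS' : IsSTPP C A B := stpp_rotate (stpp_rotate hS)
  have hAne : ∀ i, (A i).Nonempty := fun i => card_pos.1 (by rw [hA]; fin_cases i <;> simp)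
  have hBne : ∀ i, (B i).Nonempty := fun i => card_pos.1 (by rw [hB]; fin_cases i <;> simp)
  have hCne : ∀ i, (C i).Nonempty := fun i => card_pos.1 (by rw [hC]; fin_cases i <;> simp)
  have e1 : (univ : Finset (Fin 3)).erase 1 = {0, 2} := by decide
  have hz : ∑ k ∈ (univ : Finset (Fin 3)).erase 1, #(C k) * #(B k) = 14 := by
    rw [e1, Finset.sum_pair (by decide)]; simp [hB, hC]
  have hL : ∑ k ∈ (univ : Finset (Fin 3)).erase 1, #(A k) * #(B k) = 16 := by
    rw [e1, Finset.sum_pair (by decide)]; simp [hA, hB]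
  have hszsA : ([0, 2] : List (Fin 3)).map (fun k => (#(C k), #(A k), #(B k))) = [(3, 2, 2), (2, 3, 4)] := by simp [hA, hB, hC]
  have hszsB : ([0, 2] : List (Fin 3)).map (fun k => (#(A k), #(C k), #(B k))) = [(2, 3, 2), (3, 2, 4)] := by simp [hA, hB, hC]
  have hdeadA : ∀ e ∈ tblZ59L2A, CoverDead 59 3 1 [(3, 2, 2), (2, 3, 4)] e.1 e.2 :=
    coverDead_forall_of_rows (blockEnumSound_blockDiffsWQ 59) fun e he => dead59L2A e he
  have hdeadB : ∀ e ∈ tblZ59L2B, CoverDead 59 3 1 [(2, 3, 2), (3, 2, 4)] e.1 e.2 :=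
    coverDead_forall_of_rows (blockEnumSound_blockDiffsWQ 59) fun e he => dead59L2B e he
  have hdeadC : ∀ e ∈ tblZ59L2C, CoverDead 59 3 1 [(3, 2, 2), (2, 3, 4)] e.1 e.2 :=
    coverDead_forall_of_rows_swapped (blockEnumSound_blockDiffsWP 59) fun e he => dead59L2C e he
  exact no_isSTPP_of_slack_two_tables hamidouneRodsethInverseTheorem_holds hS' hCne hAne hBne 1 ⟨0, by decide⟩
    (a := 2) (b := 3) (c := 4) (L := 16) (z := 14) (vol := 24) (tblA := tblZ59L2A) (tblB := tblZ59L2B) (tblC := tblZ59L2C)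
    (by rw [hC]; rfl) (by rw [hA]; rfl) (by rw [hB]; rfl) hz hL rfl (by norm_num)
    (Or.inl rfl) (by norm_num) (by norm_num) (by norm_num) (by norm_num)
    [0, 2] (by decide) (fun k => by fin_cases k <;> decide) hszsA hszsB hdeadA hdeadB hdeadC
    rows59L2A_choose rows59L2B_choose (fun Q hQ P hP h hh => Or.inr (rows59L2C_lit Q hQ P hP h hh))

end Summit.MatrixMultiplication.OmegaCensus.CubeNB
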